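import Mathlib

/-!
# Twin-frame norm criterion — arithmetic core (plan-lens-HodgeAV-embed g2, BLOCK E4 row d3, 2026-08-29)

Crux of record: `…Theses.EightfoldBlochSeeds.BlochSeedDiscOne` (item stmt-HodgeConjecture-18881).  **Nothing in this file proves HC,
HC_AV, HC_CM, H2, 18881 or #4.**  It is the finite arithmetic behind LEMMA N of the memo
`Cruxes/BlochSeedDiscOne/TWIN-CLASS-GATE-embed-g2.md` §3.2: on a K-twinned CM frame `P = (B × B̄)^m` with `L = ℚ(ζ_N) ⊃ K = ℚ(i)`,
`[L : K] = 2`, `Gal(L/K) = {1, σ₅}` (`N = 8, 12`), the Weil coordinates `(e_T, e_T̄)` of `exp(letter)` are `(N_{L/K}(ξ₀β), conj)`, so an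
alphabet whose letters all have REAL relative norm carries no clean design with Weil part `≠ 0`.  For a phase letter `β = c·u`,
`u = ζ_N^k`, `N_{L/K}(u) = u·σ₅(u) = ζ_N^{k + 5k}`; it is real iff `ζ_N^{2(k+5k)} = 1` iff `2(k + 5k) = 0` in `ℤ/N`.

* §1 `μ₁₂` is norm-real over `ℚ(i)`: `2·(k + 5k) = 0` for every `k : ZMod 12` (indeed `k + 5k ∈ {0, 6}`), so every LINE/BAND alphabet
  `[[a₁, c u],[c ū, a₂]]`, `u ∈ μ₁₂`, of the ζ₁₂ twin frame (B ~ E_ω², the μ₆ curve) is Weil-dead (memo §0.1, §3.1 exact tables H = 2…8).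
* §2 `μ₈` is not: `2·(k + 5k) ≠ 0` for odd `k : ZMod 8` (`ζ₈·σ₅(ζ₈) = ζ₈⁶ = −i`), matching g0's design ν₈ on LINE-2 of the ζ₈ frame.
* §3 the character reading: the Weil transversal `T = {(0,a) : a ≡ 1 (4)} ∪ {(1,a) : a ≡ 3 (4)}` (a a unit mod N) has copy-0 weight
  `Σ_{a unit, a ≡ 1 (4)} a` and `T̄` has weight `Σ_{a unit, a ≡ 3 (4)} a`; they COINCIDE mod 12 (`1 + 5 = 7 + 11 = 6`) and DIFFER mod 8
  (`1 + 5 = 6`, `3 + 7 = 2`): in ζ₁₂ the Weil classes of P and the non-Weil products `e_T ⊗ e_T̄` share one phase character, in ζ₈ they do not.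
All proofs are `decide`; axioms standard.
-/

set_option linter.dupNamespace false

namespace Summit.HodgeConjecture.HodgeConjecture.Cruxes.BlochSeedDiscOne.TwinNorm

/-! ## §1 μ₁₂: the relative-norm exponent `k ↦ k + 5k` is `{0, 6}`-valued, hence norm-real -/

/-- `N_{ℚ(ζ₁₂)/ℚ(i)}(ζ₁₂^k) = ζ₁₂^{k+5k}` with `k + 5k ∈ {0, 6}`: the norm is `±1`. -/
theorem normExp_mu12_values : ∀ k : ZMod 12, k + 5 * k = 0 ∨ k + 5 * k = 6 := by decide

/-- Norm-reality of all twelve phases: `ζ₁₂^{2(k+5k)} = 1`. -/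
theorem normExp_mu12_real : ∀ k : ZMod 12, 2 * (k + 5 * k) = 0 := by decide

/-- The same for a charged phase letter `β = c·u`: `N(c u) = c² u⁶`, exponent of the root-of-unity part unchanged. (Bookkeeping form:
for every residue `c` the exponent `2(k + 5k)` still vanishes.) -/
theorem normExp_mu12_real_charged : ∀ k c : ZMod 12, c * c * (2 * (k + 5 * k)) = 0 := by decide

/-! ## §2 μ₈: odd phases have non-real relative norm -/

/-- `ζ₈ · σ₅(ζ₈) = ζ₈⁶` and `2·6 = 12 ≡ 4 ≠ 0 (mod 8)`: the norm `−i` is not real. -/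
theorem normExp_mu8_nonreal_one : (2 * ((1 : ZMod 8) + 5 * 1) ≠ 0) := by decide

/-- Exactly the odd phases of μ₈ have non-real norm over `ℚ(i)`. -/
theorem normExp_mu8_real_iff_even : ∀ k : ZMod 8, (2 * (k + 5 * k) = 0 ↔ 2 * k = 0 ∨ 2 * k = 4) := by decide

theorem normExp_mu8_nonreal_iff_odd : ∀ k : ZMod 8, (2 * (k + 5 * k) ≠ 0 ↔ (k = 1 ∨ k = 3 ∨ k = 5 ∨ k = 7)) := by decide

/-! ## §3 Weil weights: coincidence mod 12, separation mod 8 -/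

/-- Copy-0 weight of `T` (units `≡ 1 mod 4`) in `ℤ/12`: `1 + 5`. -/
def weightT12 : ZMod 12 := ((Finset.univ : Finset (ZMod 12)).filter (fun a => Nat.Coprime a.val 12 ∧ a.val % 4 = 1)).sum id
/-- Copy-0 weight of `T̄` (units `≡ 3 mod 4`) in `ℤ/12`: `7 + 11`. -/
def weightTbar12 : ZMod 12 := ((Finset.univ : Finset (ZMod 12)).filter (fun a => Nat.Coprime a.val 12 ∧ a.val % 4 = 3)).sum id
def weightT8 : ZMod 8 := ((Finset.univ : Finset (ZMod 8)).filter (fun a => Nat.Coprime a.val 8 ∧ a.val % 4 = 1)).sum id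
def weightTbar8 : ZMod 8 := ((Finset.univ : Finset (ZMod 8)).filter (fun a => Nat.Coprime a.val 8 ∧ a.val % 4 = 3)).sum id

theorem weightT12_eq : weightT12 = 6 := by decide
theorem weightTbar12_eq : weightTbar12 = 6 := by decide
/-- ζ₁₂: the Weil characters of `e_T` and `e_T̄` COINCIDE (both `6 mod 12`). -/
theorem weil_weights_coincide_mu12 : weightT12 = weightTbar12 := by decide
theorem weightT8_eq : weightT8 = 6 := by decide
theorem weightTbar8_eq : weightTbar8 = 2 := by decide
/-- ζ₈: the Weil characters of `e_T` and `e_T̄` DIFFER (`6` vs `2 mod 8`). -/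
theorem weil_weights_differ_mu8 : weightT8 ≠ weightTbar8 := by decide

/-- The four classes `e_T⊗e_T, e_T⊗e_T̄, e_T̄⊗e_T, e_T̄⊗e_T̄` of the pair frame sit in the joint characters
`(wT,wT), (wT,wT̄), (wT̄,wT), (wT̄,wT̄)`: one character in ζ₁₂, four distinct characters in ζ₈. -/
theorem pair_characters_mu12_all_equal :
    (weightT12, weightT12) = (weightT12, weightTbar12) ∧ (weightT12, weightTbar12) = (weightTbar12, weightT12) ∧
    (weightTbar12, weightT12) = (weightTbar12, weightTbar12) := by decide
theorem pair_characters_mu8_distinct :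
    (weightT8, weightT8) ≠ (weightT8, weightTbar8) ∧ (weightT8, weightT8) ≠ (weightTbar8, weightT8) ∧
    (weightT8, weightT8) ≠ (weightTbar8, weightTbar8) ∧ (weightT8, weightTbar8) ≠ (weightTbar8, weightT8) ∧
    (weightT8, weightTbar8) ≠ (weightTbar8, weightTbar8) ∧ (weightTbar8, weightT8) ≠ (weightTbar8, weightTbar8) := by decide

end Summit.HodgeConjecture.HodgeConjecture.Cruxes.BlochSeedDiscOne.TwinNorm
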